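import Literature.AlgebraicGeometry.Milne1999.SpecialLefschetzGroupInvariantsGLMultiplicity
import Literature.AlgebraicGeometry.Milne1999.SpecialLefschetzGroupInvariantsRealMultiplicationPowers
import Literature.AlgebraicGeometry.Milne1999.SpecialLefschetzGroupInvariantsSingleGenerator
import HarnessLib

/-!
# Milne 1999, Cor. 4.5 / Thm. 3.2 / Prop. 3.6 (c) with multiplicity: the `S`-invariants of ALL POWERS of a
# complex abelian variety whose `S(A)(ℂ)` is a product of general linear groups are Lefschetz classes

Family `hodge`, layer `Literature/AlgebraicGeometry/Milne1999`, namespace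
`Literature.AlgebraicGeometry.Milne1999` (D-0022). THEOREMS ONLY (three `private` definitions with bodies —
the block automorphisms `glBlockEquiv` — no named fact, no `sorry`; D-0026, net debt 0). Written for the cell
`pub-hodgecm2` (COR-CM), seat `lit-milne`, binder table `HOME/lit/milne.md` rows M2/M4 (the record
`Milne1999_specialLefschetzGroup_invariants_le` of `Milne1999/LefschetzGroup`: Cor. 4.5 with Thm. 4.4 and
Thm. 3.2, whose CONCLUSION is proved here on a new locus; its wording is untouched). Sequel of
`Milne1999/SpecialLefschetzGroupInvariantsGLMultiplicity` (the abstract criterion: Prop. 3.6 (c) WITH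
MULTIPLICITY, through the first fundamental theorem for `GL_n` on mixed tensors,
`RepresentationTheory/ClassicalInvariants/TensorFFTGeneralLinear`), of
`Milne1999/SpecialLefschetzGroupInvariantsRealMultiplicationPowers` (the same architecture for symplectic
planes, Prop. 3.6 (a)) and of `Milne1999/SpecialLefschetzGroupInvariantsImaginaryQuadratic` (ONE general
linear block, ONE copy). The first locus of the record with general linear blocks `GL_n`, `n` arbitrary, in
arbitrary number and with arbitrary multiplicity `r = N + 1`.

## Source, verbatim

J. S. Milne, *Lefschetz classes on abelian varieties*, Duke Math. J. 96 (1999) 639–675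
[`paper:doi-10-1215-s0012-7094-99-09620-5`, held; PDF page = printed page − 638; re-read 2026-08-21]:

* §1 p. 643 (p0005 L12–L13): "For any positive integer `r`, `V(A^r) = rV(A)`, and the diagonal action of
  `C(A)` on `rV(A)` identifies `C(A)` with `C(A^r)` (as `k`-algebras with involution)."  p. 644: "`S(A)`
  depends only on the isogeny class of `A`"; Prop. 1.5 (an isogeny `A₁^{r₁} × ⋯ × A_s^{r_s} → A` "induces an
  isomorphism `S(A₁) × ⋯ × S(A_s) → S(A)`").
* §2 pp. 650–651 (p0012 L63–L64, p0013 L67–L81): "Simple abelian variety of type IV. In this case `E` is a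
  division algebra whose centre is a CM-field `K`. […] `C(A) ⊗_k k^{al} = ∏_σ C_σ` where
  `C_σ ≈ End_Ē(V̄) ≈ M_{g/fd}(k^{al}) × M_{g/fd}(k^{al})`. Moreover, `S(A)_{/k^{al}} = ∏_σ S_σ` where
  `S_σ ≈ Aut_{M_d(k^{al})}(V₁) ≈ GL_{g/fd}(k^{al})`. The representation of `S_σ` on `V_σ` is isomorphic to
  the direct sum of `d` copies of the standard representation of `GL_{g/fd}(k^{al})` and `d` copies of its
  contragredient."
* Prop. 3.6 (p. 655, p0017 L13–L20): "With the above notations, `(⋀^*(rH))^G = k[(⊗² rH)^G]` all `r ≥ 1`,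
  in each of the following cases: […] (c) `G = GL(W)` and `V = W ⊕ W^∨` (`G` acts on `W^∨` via the
  contragredient representation)."; its proof (p0017 L40–L48): "we need only consider a `G`-invariant tensor
  in a space `X₁ ⊗ X₂ ⊗ ⋯ ⊗ X_m` in which each `Xᵢ` is either `W` or `W^∨`. But this space contains no
  nonzero `G`-invariant tensor unless `m` is even and there are `m/2` copies each of `W` and `W^∨`. […] The
  `G`-invariant tensors in this space are linear combinations of [the] forms `t(σ)`" — the tree's
  `ClassicalInvariants.mem_span_contractionTensor_of_forall_wordRepAt_mixedFamily_eq`.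
* p. 656 (p0018 L14–L40), "Completion of the proof of Proposition 3.4. […] `H^*(A^r) = ⋀^*(rH)` […] the
  explicit description of `S_σ` and its representation on `H_σ`, together with Proposition 3.6, show that
  each of the `k`-algebras `(⋀^* rH_σ)^{S_σ}` is generated by tensors of degree 2".
* Prop. 3.3 (p. 653): "`H²(A)^{S(A)} = NS(A) ⊗ k`"; Cor. 4.5 (p. 659, p0021 L24–L25): "For any abelian variety
  `A` and any `r ≥ 0`, `H^{2*}(A^r)(*)^{L(A)} = D_hom(A^r)_k`."; Cor. 4.7 (p. 659); Prop. 4.8 (p. 660).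

## What is proved (complex `A`, Betti cohomology, the tree's carriers)

DATA: `φ ∈ End(A)` with `φ^*` diagonalisable on `H¹(A(ℂ); ℂ)` and `C(A) ⊗ ℂ = centralizerAlgebra A` the
commutant of `φ^*` (`End⁰(A) ⊗ ℂ` and `ℂ[φ^*]` have the same commutant); a rational class `h` with a Kähler
multiple; an operator `J'` commuting with `C(A) ⊗ ℂ` and `Q_h`-adjoint to `φ^*` (`Q_h(φ^*x, y) = Q_h(x, J'y)`;
e.g. `J' = (φ†)^*`, `†` the Rosati involution of `h`), PLUS the general-linear-type conditions: EVERY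
EIGENSPACE `V_ν` OF `φ^*` IS `Q_h`-ISOTROPIC and the eigenspaces have a common dimension `n`. (E.g.
`End⁰(A) = K = ℚ(φ)` a CM-field acting on `H¹(A; ℚ)`: `V_τ = H¹ ⊗_{K,τ} ℂ` has dimension `2 dim A/[K:ℚ]`
for every `τ : K → ℂ`, and `Q_h(φ^*x, y) = τ(φ) Q_h(x, y) = Q_h(x, φ̄^*y) = τ̄(φ) Q_h(x, y)` on `V_τ × V_τ`
with `τ(φ) ∉ ℝ` — Milne's type IV with `E = K`, `d = 1`; `n = 1` is the CM case, `[K : ℚ] = 2` the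
imaginary-quadratic case.) Then (`exists_blockBasis_of_orthogonality`, the isotropy and `hn`)
`H¹(A(ℂ); ℂ) = ⊕_k (V_{ν_k} ⊕ V_{ν̄_k})` with `ν̄_k ≠ ν_k`, `Q_h` pairing `V_{ν_k}` perfectly with `V_{ν̄_k}`
and vanishing elsewhere, all blocks of size `n + n`, and `S(A)(ℂ) ⊇ ∏_k GL_n` acting by `g_k` on `V_{ν_k}`
and by `(g_k⁻¹)ᵀ` on `V_{ν̄_k}` ("the standard representation and its contragredient"). For every `N`, with
`A^{N+1} = A.powSucc N` and Milne's product class `Σᵢ prᵢ^* h = powPolarizationClass A h N`: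

* **`mem_divisorClassesSpan_powSucc_of_forall_exteriorPullback_eq_of_isotropic`** — the `S(ℂ)`-form of
  Cor. 4.5 on `A^{N+1}`: every class of `H^{2p}(A^{N+1}(ℂ); ℂ)` fixed by `⋀^{2p}u` for all
  `u ∈ S(A^{N+1})(ℂ) = unitaryCentralizerGroup (A.powSucc N) (powPolarizationClass A h N)` lies in
  `Dᵖ(A^{N+1}) ⊗ ℂ`. Proof ("each of the `k`-algebras `(⋀^* rH_σ)^{S_σ}` is generated by tensors of degree
  2", `r = N + 1`, `S_σ = GL_n`): the criterion
  `mem_divisorClassesSpan_of_forall_exteriorPullback_eq_of_glColouring` of the `GL`-multiplicity file on the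
  LETTERS `prⱼ^* e^k_i` (vector slots `(j, k)`, colour `k`) and `prⱼ^* f^k_i` (covector slots) — a basis of
  `H¹(A^{N+1})` by `mem_span_map_powSlots` and a dimension count; the required elements of `S(A^{N+1})(ℂ)`
  over `g ∈ ∏_k GL_n(ℂ)` are the DIAGONAL images `u^{⊕(N+1)}` (`LefschetzCentraliserPowers.diagPow`,
  `diagPow_mem_unitaryCentralizerGroup`, acting letter by letter by `diagPow_intertwine_right`) of the block
  automorphisms `glBlockEquiv b g ∈ S(A)(ℂ)` (§1: they commute with `φ^*`, hence with `End(A)` by the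
  commutant hypothesis, and preserve `Q_h`); the crossed classes `Σᵢ prⱼ^* e^k_i ⌣ pr_{j'}^* f^k_i` are
  divisor classes (§2, `sum_cross_mem_span_rational_oneOne_of_eigen`: with `ψ = prⱼ + pr_{j'} ∘ φ`,
  `(ν̄_k − ν_k) · Σᵢ prⱼ^*e_i ⌣ pr_{j'}^*f_i ∈ ⟨(prⱼ + pr_{j'})^*θ_k, ψ^*θ_k, prⱼ^*θ_k, pr_{j'}^*θ_k⟩`)
  because `θ_k = Σᵢ e^k_i ⌣ f^k_i ∈ B¹(A) ⊗ ℂ` — it is fixed by every `u ∈ S(A)(ℂ)` (§2,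
  `exteriorPullback_sum_cupProduct_eq_self_of_blocks`: `u` preserves `V_{ν_k}`, `V_{ν̄_k}` and their
  pairing, so acts on `V_{ν̄_k}` by the contragredient) and the `S(A)(ℂ)`-invariants of `H²` are the
  divisor classes (Prop. 3.3 in the tree's `S(ℂ)`-form `mem_hodgeClassSpan_of_forall_exteriorPullback_eq`,
  `SpecialLefschetzGroupInvariantsHodgeClasses`).
* **`exists_polarization_invariants_le_powSucc_of_isotropic`** — the polarization package of `A^{N+1}`
  (the class `Σᵢ prᵢ^* h` with its three hypotheses, `SpecialLefschetzGroupOneEqUnitaryCentralizer` §Powers),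
  the datum consumed by `SpecialLefschetzGroupInvariantsFiniteProducts`
  (`exists_polarization_invariants_le_biproduct_of_forall_exists`: packages of factors ⇒ packages of finite
  `Hom`-orthogonal products), so these powers now enter those products as packaged factors.
* **`specialLefschetzGroup_invariants_le_powSucc_of_isotropic`** — the CONCLUSION of the record
  `Milne1999_specialLefschetzGroup_invariants_le` for every power `A^{N+1}`; `…_of_isIsogenous_powSucc_…`
  for every complex abelian variety isogenous to such a power (Cor. 4.7 / Prop. 1.5); Cor. 4.5 as an
  equality of sets and Prop. 4.8 (c) ⇒ (a) on `A^{N+1}`, hypotheses closed.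

NOT here: (i) the derivation of the two general-linear-type conditions from "`End⁰(A) ⊇ K = ℚ(φ)` a
CM-field, `†|_K = ` complex conjugation" (the instance above is informal); (ii) type IV with `d > 1`
(non-commutative `E`), where `C(A) ⊗ ℂ` is not the commutant of one `φ^*`; (iii) powers of abelian varieties
whose `S(A)(ℂ)` has symplectic blocks of rank `≥ 4` or orthogonal blocks (types I with `[F : ℚ] < dim A`, II,
III): Prop. 3.6 (a) for `Sp_{2n}`, `n ≥ 2`, and (b) for `O_n` with multiplicity are not in the tree; the
record itself is NOT discharged.

## References

* [Milne1999LefschetzClasses] J. S. Milne, Lefschetz classes on abelian varieties, Duke Math. J. 96 (1999)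
  639–675: §1 pp. 643–644 and Prop. 1.5, §2 pp. 650–651 (type IV), Lemma 3.1, Thm. 3.2, Props. 3.3–3.4,
  3.6 (c), Remark 3.7 (pp. 652–656), Thm. 4.4, Cor. 4.5, Cor. 4.7 (p. 659), Prop. 4.8 (p. 660).
* [GoodmanWallachGTM255] R. Goodman, N. R. Wallach, Symmetry, Representations, and Invariants, GTM 255
  (2009), Thm. 4.2.10, Thm. 5.3.1.
* [HatcherAT2002] A. Hatcher, Algebraic Topology (2002), §3.2 Prop. 3.10 (naturality of the cup product).
* [LangeBirkenhake1992] H. Lange, Ch. Birkenhake, Complex Abelian Varieties (1992), §5.5 (endomorphism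
  algebras of type IV and the Rosati involution).
-/

noncomputable section

open scoped BigOperators Matrix
open CategoryTheory
open Literature.AlgebraicTopology.SingularHomology
open Literature.AlgebraicGeometry.HodgeTheory
open Literature.AlgebraicGeometry.Motives
open Literature.AlgebraicGeometry.VanGeemen1994 (pullbackOne hodgeClassSpan)
open Literature.Barriers.HodgeConjecture (divisorClassesSpan divisorMonomials mem_divisorMonomials_zero)
open Literature.Geometry.Kaehler (lefschetzPow)
open Literature.RepresentationTheory.GeneralLinear
open Literature.RepresentationTheory.ClassicalInvariants
open Literature.NumberTheory.DiophantineGeometry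

namespace Literature.AlgebraicGeometry.Milne1999

/-! ### §1 Linear algebra: eigenspaces spanned by an eigenbasis; the general linear block datum -/

section Eigenbasis

variable {V : Type*} [AddCommGroup V] [Module ℂ V] {ι : Type*} [Fintype ι]

/-- **An eigenspace of an operator with an eigenbasis is spanned by the basis vectors of that eigenvalue**
(coordinates: `J x = μ x` forces the coordinate of `x` at a basis vector of eigenvalue `≠ μ` to vanish).
[cite: Milne1999LefschetzClasses, §2 p. 648 (`V(A) ⊗ ℂ = ⊕_σ V_σ`)] -/
theorem eigenspace_eq_span_image_of_eigenbasis (b : Module.Basis ι ℂ V) (J : Module.End ℂ V) (ev : ι → ℂ)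
    (hJ : ∀ a, J (b a) = ev a • b a) (μ : ℂ) :
    J.eigenspace μ = Submodule.span ℂ (b '' {a | ev a = μ}) := by
  refine le_antisymm (fun x hx => ?_) (Submodule.span_le.2 ?_)
  · rw [Module.End.mem_eigenspace_iff] at hx
    have hcoef : ∀ a, b.repr x a * ev a = μ * b.repr x a := by
      intro a
      have h1 : J x = ∑ a, (b.repr x a * ev a) • b a := by
        conv_lhs => rw [← b.sum_repr x]
        rw [map_sum]
        refine Finset.sum_congr rfl fun a _ => ?_
        rw [map_smul, hJ, smul_smul]
      have h2 : μ • x = ∑ a, (μ * b.repr x a) • b a := by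
        conv_lhs => rw [← b.sum_repr x]
        rw [Finset.smul_sum]
        refine Finset.sum_congr rfl fun a _ => ?_
        rw [smul_smul]
      have e := congrArg (fun v => b.repr v a) (hx.symm.trans h1 |>.symm.trans h2 |>.symm)
      simp only [b.repr_sum_self] at e
      exact e.symm
    rw [← b.sum_repr x]
    refine Submodule.sum_mem _ fun a _ => ?_
    by_cases ha : ev a = μ
    · exact Submodule.smul_mem _ _ (Submodule.subset_span ⟨a, ha, rfl⟩)
    · have h0 : b.repr x a = 0 := by
        have e := hcoef a
        rw [mul_comm μ] at e
        exact (mul_eq_mul_left_iff.1 e).resolve_left ha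
      rw [h0, zero_smul]
      exact Submodule.zero_mem _
  · rintro _ ⟨a, ha, rfl⟩
    rw [SetLike.mem_coe, Module.End.mem_eigenspace_iff, hJ a, ha.symm]

end Eigenbasis

section GLBlocks

variable {V : Type*} [AddCommGroup V] [Module ℂ V] {κ : Type*} {n : ℕ}

/-- The matrix by which `g ∈ ∏_k GL_n(ℂ)` acts on the slot of block `k` and type `β`: `g_k` on a vector
slot, `(g_k⁻¹)ᵀ` on a covector slot (standard ⊕ contragredient, Milne p. 651). [cite: Milne1999LefschetzClasses, §2 p. 651] -/
private def slotMat (g : κ → GL (Fin n) ℂ) (k : κ) (β : Bool) : Matrix (Fin n) (Fin n) ℂ :=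
  if β then (g k : Matrix (Fin n) (Fin n) ℂ) else (((g k)⁻¹ : GL (Fin n) ℂ) : Matrix (Fin n) (Fin n) ℂ)ᵀ

/-- The slot matrix of a vector slot is `g_k`. [folklore] -/
private theorem slotMat_true (g : κ → GL (Fin n) ℂ) (k : κ) :
    slotMat g k true = (g k : Matrix (Fin n) (Fin n) ℂ) := by
  simp [slotMat]

/-- The slot matrix of a covector slot is `(g_k⁻¹)ᵀ`. [folklore] -/
private theorem slotMat_false (g : κ → GL (Fin n) ℂ) (k : κ) :
    slotMat g k false = (((g k)⁻¹ : GL (Fin n) ℂ) : Matrix (Fin n) (Fin n) ℂ)ᵀ := by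
  simp [slotMat]

/-- `g ↦ (g_k⁻¹)ᵀ` is multiplicative, so the slot matrices are. [folklore] -/
private theorem slotMat_mul (g g' : κ → GL (Fin n) ℂ) (k : κ) (β : Bool) :
    slotMat (g * g') k β = slotMat g k β * slotMat g' k β := by
  cases β
  · rw [slotMat_false, slotMat_false, slotMat_false, Pi.mul_apply, mul_inv_rev, Units.val_mul,
      Matrix.transpose_mul]
  · rw [slotMat_true, slotMat_true, slotMat_true, Pi.mul_apply, Units.val_mul]

/-- The slot matrices of `g = 1` are `1`. [folklore] -/
private theorem slotMat_one (k : κ) (β : Bool) : slotMat (1 : κ → GL (Fin n) ℂ) k β = 1 := by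
  cases β
  · rw [slotMat_false, Pi.one_apply, inv_one, Units.val_one, Matrix.transpose_one]
  · rw [slotMat_true, Pi.one_apply, Units.val_one]

variable (b : Module.Basis ((κ × Bool) × Fin n) ℂ V)

/-- The linear map acting on the slot `(k, β)` by the slot matrix of `g`. [folklore] -/
private def glBlockLin (g : κ → GL (Fin n) ℂ) : V →ₗ[ℂ] V :=
  b.constr ℂ fun a => ∑ i', slotMat g a.1.1 a.1.2 i' a.2 • b (a.1, i')

/-- `glBlockLin` on a basis vector. [folklore] -/
private theorem glBlockLin_basis (g : κ → GL (Fin n) ℂ) (a : (κ × Bool) × Fin n) :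
    glBlockLin b g (b a) = ∑ i', slotMat g a.1.1 a.1.2 i' a.2 • b (a.1, i') := by
  rw [glBlockLin, Module.Basis.constr_basis]

/-- `glBlockLin` is multiplicative (the contragredient `g ↦ (g⁻¹)ᵀ` is a homomorphism). [folklore] -/
private theorem glBlockLin_mul (g g' : κ → GL (Fin n) ℂ) :
    glBlockLin b (g * g') = glBlockLin b g ∘ₗ glBlockLin b g' := by
  refine b.ext fun a => ?_
  rw [LinearMap.comp_apply, glBlockLin_basis, glBlockLin_basis, map_sum]
  simp_rw [map_smul, glBlockLin_basis, Finset.smul_sum, smul_smul]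
  rw [Finset.sum_comm]
  refine Finset.sum_congr rfl fun i'' _ => ?_
  rw [← Finset.sum_smul, slotMat_mul, Matrix.mul_apply]
  congr 1
  exact Finset.sum_congr rfl fun j _ => mul_comm _ _

/-- `glBlockLin 1 = id`. [folklore] -/
private theorem glBlockLin_one : glBlockLin b (1 : κ → GL (Fin n) ℂ) = LinearMap.id := by
  refine b.ext fun a => ?_
  rw [glBlockLin_basis, LinearMap.id_apply, Finset.sum_eq_single a.2]
  · rw [slotMat_one, Matrix.one_apply_eq, one_smul]
  · intro i' _ hi'
    rw [slotMat_one, Matrix.one_apply_ne hi', zero_smul]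
  · intro h
    exact absurd (Finset.mem_univ _) h

/-- **The element of `∏_k GL(W_k)` attached to `g`, as an automorphism of `V`**: acts on the vector slots
of block `k` by `g_k` and on the covector slots by `(g_k⁻¹)ᵀ`. [cite: Milne1999LefschetzClasses, §2 p. 651] -/
private def glBlockEquiv (g : κ → GL (Fin n) ℂ) : V ≃ₗ[ℂ] V :=
  LinearEquiv.ofLinear (glBlockLin b g) (glBlockLin b g⁻¹)
    (by rw [← glBlockLin_mul, mul_inv_cancel, glBlockLin_one])
    (by rw [← glBlockLin_mul, inv_mul_cancel, glBlockLin_one])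

/-- `glBlockEquiv` on a basis vector. [folklore] -/
private theorem glBlockEquiv_basis (g : κ → GL (Fin n) ℂ) (a : (κ × Bool) × Fin n) :
    glBlockEquiv b g (b a) = ∑ i', slotMat g a.1.1 a.1.2 i' a.2 • b (a.1, i') :=
  glBlockLin_basis b g a

/-- The block automorphisms commute with every operator which is a scalar on each slot
(`J b((k,β),i) = ev(k,β) • b((k,β),i)`). [folklore] -/
private theorem glBlockEquiv_comm (g : κ → GL (Fin n) ℂ) (J : Module.End ℂ V) (ev : κ × Bool → ℂ)
    (hJ : ∀ a, J (b a) = ev a.1 • b a) :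
    J * (glBlockEquiv b g : Module.End ℂ V) = (glBlockEquiv b g : Module.End ℂ V) * J := by
  refine b.ext fun a => ?_
  rw [Module.End.mul_apply, Module.End.mul_apply, LinearEquiv.coe_coe, glBlockEquiv_basis, hJ, map_smul,
    glBlockEquiv_basis, map_sum, Finset.smul_sum]
  refine Finset.sum_congr rfl fun i' _ => ?_
  rw [map_smul, hJ, smul_smul, smul_smul, mul_comm]

/-- The block automorphisms preserve a bilinear form for which the blocks are mutually orthogonal, the
vector slots and the covector slots are isotropic, and `B(e^k_i, f^k_j) = δ_{ij} = -B(f^k_j, e^k_i)`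
(standard ⊕ contragredient preserves the pairing). [cite: Milne1999LefschetzClasses, §2 p. 651] -/
private theorem glBlockEquiv_preserves (g : κ → GL (Fin n) ℂ) (B : LinearMap.BilinForm ℂ V)
    (hcross : ∀ a a', a.1.1 ≠ a'.1.1 → B (b a) (b a') = 0)
    (htt : ∀ k i j, B (b ((k, true), i)) (b ((k, true), j)) = 0)
    (hff : ∀ k i j, B (b ((k, false), i)) (b ((k, false), j)) = 0)
    (htf : ∀ k i j, B (b ((k, true), i)) (b ((k, false), j)) = if i = j then 1 else 0)
    (hft : ∀ k i j, B (b ((k, false), i)) (b ((k, true), j)) = if i = j then -1 else 0)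
    (x y : V) : B (glBlockEquiv b g x) (glBlockEquiv b g y) = B x y := by
  classical
  suffices h : B.comp (glBlockEquiv b g : V →ₗ[ℂ] V) (glBlockEquiv b g : V →ₗ[ℂ] V) = B by
    have := LinearMap.congr_fun₂ h x y
    rwa [LinearMap.BilinForm.comp_apply] at this
  refine LinearMap.BilinForm.ext_basis b fun a a' => ?_
  rw [LinearMap.BilinForm.comp_apply, LinearEquiv.coe_coe, glBlockEquiv_basis, glBlockEquiv_basis]
  simp only [map_sum, map_smul, LinearMap.sum_apply, LinearMap.smul_apply, smul_eq_mul]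
  obtain ⟨⟨k, β⟩, i⟩ := a
  obtain ⟨⟨k', β'⟩, j⟩ := a'
  by_cases hk : k = k'
  · subst hk
    cases β <;> cases β'
    · -- covector, covector
      simp only [hff, mul_zero, Finset.sum_const_zero]
    · -- covector, vector: `-(g⁻¹ g)_{i j}`
      simp only [hft, slotMat_false, slotMat_true, Matrix.transpose_apply, mul_ite, mul_neg, mul_one, mul_zero,
        Finset.sum_ite_eq', Finset.mem_univ, if_true, Finset.sum_neg_distrib]
      rw [show (∑ x : Fin n, (g k : Matrix (Fin n) (Fin n) ℂ) x j *
          (((g k)⁻¹ : GL (Fin n) ℂ) : Matrix (Fin n) (Fin n) ℂ) i x) = ((((g k)⁻¹ : GL (Fin n) ℂ) : Matrix (Fin n) (Fin n) ℂ) *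
            (g k : Matrix (Fin n) (Fin n) ℂ)) i j from by
            rw [Matrix.mul_apply]; exact Finset.sum_congr rfl fun x _ => mul_comm _ _,
        ← Units.val_mul, inv_mul_cancel, Units.val_one, Matrix.one_apply]
      split_ifs <;> simp
    · -- vector, covector: `(gᵀ g⁻ᵀ)_{i j} = (g⁻¹ g)_{j i}`
      simp only [htf, slotMat_false, slotMat_true, Matrix.transpose_apply, mul_ite, mul_one, mul_zero,
        Finset.sum_ite_eq', Finset.mem_univ, if_true]
      rw [show (∑ x : Fin n, (((g k)⁻¹ : GL (Fin n) ℂ) : Matrix (Fin n) (Fin n) ℂ) j x *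
          (g k : Matrix (Fin n) (Fin n) ℂ) x i) =
          ((((g k)⁻¹ : GL (Fin n) ℂ) : Matrix (Fin n) (Fin n) ℂ) * (g k : Matrix (Fin n) (Fin n) ℂ)) j i from
            (Matrix.mul_apply).symm,
        ← Units.val_mul, inv_mul_cancel, Units.val_one, Matrix.one_apply]
      split_ifs with h1 h2 h2
      · rfl
      · exact absurd h1.symm h2
      · exact absurd h2.symm h1
      · rfl
    · -- vector, vector
      simp only [htt, mul_zero, Finset.sum_const_zero]
  · have h0 : ∀ (i' j' : Fin n) (β β' : Bool), B (b ((k, β), i')) (b ((k', β'), j')) = 0 :=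
      fun i' j' β β' => hcross _ _ hk
    simp only [h0, mul_zero, Finset.sum_const_zero]

end GLBlocks

/-! ### §2 On `H¹(A(ℂ); ℂ)`: the pairings `θ_k = Σᵢ e^k_i ⌣ f^k_i` are divisor classes; their crossed pull-backs to `A^{N+1}` -/

section Pairings

variable {A : AbelianVariety ℂ} {κ : Type*} {n : ℕ}

/-- **`⋀²u` fixes the pairing class `θ_k = Σᵢ e^k_i ⌣ f^k_i` of a general linear block** for every
automorphism `u` of `H¹` commuting with the block-scalar operator `J` (so `u` preserves `V_{ν_k} = ⟨e^k_i⟩`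
and `V_{ν̄_k} = ⟨f^k_i⟩`) and preserving a form `B` with `B(e^k_i, f^k_j) = δ_{ij}` (so `u|V_{ν̄_k}` is the
contragredient of `u|V_{ν_k}`: `αᵀ γ = 1`, whence `Σᵢ u e_i ⌣ u f_i = Σ_{i',j'} (α γᵀ)_{i'j'} e_{i'} ⌣ f_{j'}
= θ_k`). Milne p. 651 ("standard representation and its contragredient"), Prop. 3.3 (degree-`2`
invariants). [cite: Milne1999LefschetzClasses, §2 p. 651 and Prop. 3.3 (p. 653)] -/
theorem exteriorPullback_sum_cupProduct_eq_self_of_blocks [Fintype κ]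
    (b : Module.Basis ((κ × Bool) × Fin n) ℂ (complexBetti A.X 1))
    (B : LinearMap.BilinForm ℂ (complexBetti A.X 1))
    (htf : ∀ k i j, B (b ((k, true), i)) (b ((k, false), j)) = if i = j then 1 else 0)
    (J : Module.End ℂ (complexBetti A.X 1)) (ev : κ × Bool → ℂ) (hJ : ∀ a, J (b a) = ev a.1 • b a)
    (hev : ∀ s s', ev s = ev s' → s = s') (k : κ)
    (u : complexBetti A.X 1 ≃ₗ[ℂ] complexBetti A.X 1) (huJ : ∀ v, J (u v) = u (J v))
    (huB : ∀ x y, B (u x) (u y) = B x y) :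
    exteriorPullback (AbelianVariety.hasExteriorCohomologyH1_complexPoints A)
        (u : complexBetti A.X 1 →ₗ[ℂ] complexBetti A.X 1) 2
        (∑ i, cupProduct (rfl : 1 + 1 = 2) (b ((k, true), i)) (b ((k, false), i))) =
      ∑ i, cupProduct (rfl : 1 + 1 = 2) (b ((k, true), i)) (b ((k, false), i)) := by
  classical
  have hX := AbelianVariety.hasExteriorCohomologyH1_complexPoints A
  -- `u` maps each slot into its own span (it preserves the eigenspaces of `J`)
  have hspan : ∀ (s : κ × Bool) (i : Fin n),
      u (b (s, i)) ∈ Submodule.span ℂ (Set.range fun i' => b (s, i')) := by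
    intro s i
    have hmem : u (b (s, i)) ∈ J.eigenspace (ev s) := by
      rw [Module.End.mem_eigenspace_iff, huJ, hJ, map_smul]
    rw [eigenspace_eq_span_image_of_eigenbasis b J (fun a => ev a.1) hJ] at hmem
    have hset : (b '' {a : (κ × Bool) × Fin n | ev a.1 = ev s}) = Set.range fun i' => b (s, i') := by
      ext v
      constructor
      · rintro ⟨a, ha, rfl⟩
        exact ⟨a.2, by rw [← hev _ _ ha]⟩
      · rintro ⟨i', rfl⟩
        exact ⟨(s, i'), rfl, rfl⟩
    rwa [hset] at hmem
  have hcoef := fun (s : κ × Bool) (i : Fin n) => Submodule.mem_span_range_iff_exists_fun ℂ |>.1 (hspan s i)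
  choose coef hcoef using hcoef
  -- `α_{i' i}`, `γ_{j' j}`: the matrices of `u` on the two slots of block `k`
  set α : Matrix (Fin n) (Fin n) ℂ := fun i' i => coef (k, true) i i' with hα
  set γ : Matrix (Fin n) (Fin n) ℂ := fun j' j => coef (k, false) j j' with hγ
  have hue : ∀ i, u (b ((k, true), i)) = ∑ i', α i' i • b ((k, true), i') := fun i => (hcoef (k, true) i).symm
  have huf : ∀ j, u (b ((k, false), j)) = ∑ j', γ j' j • b ((k, false), j') := fun j => (hcoef (k, false) j).symm
  -- `αᵀ γ = 1` from `B(u e_i, u f_j) = B(e_i, f_j) = δ_{ij}`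
  have hαγ : αᵀ * γ = 1 := by
    ext i j
    have e := huB (b ((k, true), i)) (b ((k, false), j))
    rw [hue, huf, htf] at e
    simp only [map_sum, map_smul, LinearMap.sum_apply, LinearMap.smul_apply, smul_eq_mul, htf, mul_ite, mul_one,
      mul_zero, Finset.sum_ite_eq', Finset.mem_univ, if_true] at e
    rw [Matrix.mul_apply, Matrix.one_apply, ← e]
    refine Finset.sum_congr rfl fun i' _ => ?_
    rw [Matrix.transpose_apply, mul_comm]
  have hγα : α * γᵀ = 1 := by
    have h1 : γ * αᵀ = 1 := mul_eq_one_comm.1 hαγ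
    have h2 := congrArg Matrix.transpose h1
    rwa [Matrix.transpose_mul, Matrix.transpose_transpose, Matrix.transpose_one] at h2
  -- expand `Σᵢ u e_i ⌣ u f_i`
  rw [map_sum]
  have hterm : ∀ i, exteriorPullback hX (u : complexBetti A.X 1 →ₗ[ℂ] complexBetti A.X 1) 2
      (cupProduct (rfl : 1 + 1 = 2) (b ((k, true), i)) (b ((k, false), i))) =
      ∑ i', ∑ j', (α i' i * γ j' i) • cupProduct (rfl : 1 + 1 = 2) (b ((k, true), i')) (b ((k, false), j')) := by
    intro i
    rw [exteriorPullback_cupProduct_one_one A hX]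
    change cupProduct (rfl : 1 + 1 = 2) (u (b ((k, true), i))) (u (b ((k, false), i))) = _
    rw [hue, huf]
    simp only [map_sum, map_smul, LinearMap.sum_apply, LinearMap.smul_apply, Finset.smul_sum, smul_smul]
    rw [Finset.sum_comm]
    refine Finset.sum_congr rfl fun i' _ => Finset.sum_congr rfl fun j' _ => ?_
    rw [mul_comm]
  simp_rw [hterm]
  rw [Finset.sum_comm]
  refine Finset.sum_congr rfl fun i' _ => ?_
  rw [Finset.sum_comm, Finset.sum_eq_single i']
  · rw [← Finset.sum_smul]
    have h1 : (∑ i, α i' i * γ i' i) = 1 := by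
      have := congrArg (fun M : Matrix (Fin n) (Fin n) ℂ => M i' i') hγα
      simpa [Matrix.mul_apply, Matrix.transpose_apply] using this
    rw [h1, one_smul]
  · intro j' _ hj'
    rw [← Finset.sum_smul]
    have h0 : (∑ i, α i' i * γ j' i) = 0 := by
      have := congrArg (fun M : Matrix (Fin n) (Fin n) ℂ => M i' j') hγα
      simpa [Matrix.mul_apply, Matrix.transpose_apply, Matrix.one_apply_ne (Ne.symm hj')] using this
    rw [h0, zero_smul]
  · intro h
    exact absurd (Finset.mem_univ _) h

/-- **The crossed pull-backs `Σᵢ g^*e_i ⌣ g'^*f_i` of the pairing class of a general linear block are divisor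
classes** on `T`, for homomorphisms `g, g' : T → A`, when `θ = Σᵢ e_i ⌣ f_i ∈ B¹(A) ⊗ ℂ`, the `e_i` lie in
`V_ν(φ^*)`, the `f_i` in `V_{ν'}(φ^*)` and `ν ≠ ν'`: with `S = Σᵢ g^*e_i ⌣ g'^*f_i`, `S' = Σᵢ g'^*e_i ⌣ g^*f_i`,
`(g + g')^*θ = g^*θ + g'^*θ + S + S'` and `(g + g' φ)^*θ = g^*θ + νν' g'^*θ + ν' S + ν S'`, so
`(ν' − ν) S ∈ B¹(T) ⊗ ℂ` (pull-backs of divisor classes are divisor classes). Milne Prop. 3.3 on `A^r` /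
Lemma 3.1 (the graph classes of `Hom`). [cite: Milne1999LefschetzClasses, Prop. 3.3 and Lemma 3.1 (pp. 652–653)]
[cite: HatcherAT2002, §3.2 Prop. 3.10] -/
theorem sum_cross_mem_span_rational_oneOne_of_eigen {T : AbelianVariety ℂ} (φ : A ⟶ A)
    (g g' : T ⟶ A) {ι' : Type*} [Fintype ι'] (e f : ι' → complexBetti A.X 1) {ν ν' : ℂ} (hne : ν ≠ ν')
    (he : ∀ i, pullbackOne A φ (e i) = ν • e i) (hf : ∀ i, pullbackOne A φ (f i) = ν' • f i)
    (hθ : (∑ i, cupProduct (rfl : 1 + 1 = 2) (e i) (f i)) ∈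
      Submodule.span ℂ {c : complexBetti A.X 2 | IsRationalClass c ∧ IsOfHodgeType A.dim A.X 2 1 1 c}) :
    (∑ i, cupProduct (rfl : 1 + 1 = 2) (complexBetti.map g.hom.hom.hom 1 (e i))
        (complexBetti.map g'.hom.hom.hom 1 (f i))) ∈
      Submodule.span ℂ {c : complexBetti T.X 2 | IsRationalClass c ∧ IsOfHodgeType T.dim T.X 2 1 1 c} := by
  have hT : IsSmoothProjective T.dim T.X := AbelianVariety.isSmoothProjective_holds
  have hAs : IsSmoothProjective A.dim A.X := AbelianVariety.isSmoothProjective_holds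
  set M := Submodule.span ℂ {c : complexBetti T.X 2 | IsRationalClass c ∧ IsOfHodgeType T.dim T.X 2 1 1 c} with hM
  set θ : complexBetti A.X 2 := ∑ i, cupProduct (rfl : 1 + 1 = 2) (e i) (f i) with hθdef
  set S : complexBetti T.X 2 := ∑ i, cupProduct (rfl : 1 + 1 = 2) (complexBetti.map g.hom.hom.hom 1 (e i))
    (complexBetti.map g'.hom.hom.hom 1 (f i)) with hS
  set S' : complexBetti T.X 2 := ∑ i, cupProduct (rfl : 1 + 1 = 2) (complexBetti.map g'.hom.hom.hom 1 (e i))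
    (complexBetti.map g.hom.hom.hom 1 (f i)) with hS'
  have hpull : ∀ ψ : T ⟶ A, complexBetti.map ψ.hom.hom.hom 2 θ =
      ∑ i, cupProduct (rfl : 1 + 1 = 2) (complexBetti.map ψ.hom.hom.hom 1 (e i))
        (complexBetti.map ψ.hom.hom.hom 1 (f i)) := by
    intro ψ
    rw [hθdef, map_sum]
    exact Finset.sum_congr rfl fun i _ => complexBetti.map_cupProduct _ _ _ _
  have hmemθ : ∀ ψ : T ⟶ A, complexBetti.map ψ.hom.hom.hom 2 θ ∈ M := fun ψ =>
    map_mem_span_rational_oneOne hT hAs _ hθ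
  have hadd : ∀ v : complexBetti A.X 1, complexBetti.map (g + g').hom.hom.hom 1 v =
      complexBetti.map g.hom.hom.hom 1 v + complexBetti.map g'.hom.hom.hom 1 v :=
    fun v => complexBetti_map_add_deg_one g g' v
  have hadd' : ∀ v : complexBetti A.X 1, complexBetti.map (g + g' ≫ φ).hom.hom.hom 1 v =
      complexBetti.map g.hom.hom.hom 1 v + complexBetti.map g'.hom.hom.hom 1 (pullbackOne A φ v) := by
    intro v
    rw [complexBetti_map_add_deg_one, complexBetti_map_map_hom]
  -- `S + S' = (g + g')^*θ − g^*θ − g'^*θ`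
  have key1 : S + S' = complexBetti.map (g + g').hom.hom.hom 2 θ - complexBetti.map g.hom.hom.hom 2 θ -
      complexBetti.map g'.hom.hom.hom 2 θ := by
    rw [hpull, hpull, hpull, hS, hS']
    simp only [hadd, map_add, LinearMap.add_apply, Finset.sum_add_distrib]
    abel
  -- `ν' S + ν S' = (g + g'φ)^*θ − g^*θ − ν ν' g'^*θ`
  have key2 : ν' • S + ν • S' = complexBetti.map (g + g' ≫ φ).hom.hom.hom 2 θ - complexBetti.map g.hom.hom.hom 2 θ -
      (ν * ν') • complexBetti.map g'.hom.hom.hom 2 θ := by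
    rw [hpull, hpull, hpull, hS, hS']
    simp only [hadd', he, hf, map_add, map_smul, LinearMap.add_apply, LinearMap.smul_apply, smul_add, smul_smul,
      Finset.sum_add_distrib, Finset.smul_sum, mul_comm ν ν']
    abel
  have h1 : S + S' ∈ M := by
    rw [key1]
    exact M.sub_mem (M.sub_mem (hmemθ _) (hmemθ _)) (hmemθ _)
  have h2 : ν' • S + ν • S' ∈ M := by
    rw [key2]
    exact M.sub_mem (M.sub_mem (hmemθ _) (hmemθ _)) (M.smul_mem _ (hmemθ _))
  have h3 : (ν' - ν) • S ∈ M := by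
    have e : (ν' - ν) • S = (ν' • S + ν • S') - ν • (S + S') := by
      rw [sub_smul, smul_add]; abel
    rw [e]
    exact M.sub_mem h2 (M.smul_mem _ h1)
  exact (M.smul_mem_iff (sub_ne_zero.2 (Ne.symm hne))).1 h3

end Pairings

/-! ### §3 The `S(ℂ)`-form of Cor. 4.5 on the powers `A^{N+1}` of an abelian variety with general linear blocks only -/

section Main

variable {A : AbelianVariety ℂ}

/-- **Milne 1999, Cor. 4.5 / Thm. 3.2 / Prop. 3.6 (c) with multiplicity, `S(ℂ)`-form on the powers of an
abelian variety whose `S(A)(ℂ)` is a product of general linear groups.** Let `A` be a complex abelian variety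
with `φ ∈ End(A)` such that `φ^*` is diagonalisable on `H¹(A(ℂ); ℂ)`, `C(A) ⊗ ℂ` is the commutant of `φ^*`,
`h` a polarization class (rational, with a Kähler multiple) and `J'` an operator commuting with `C(A) ⊗ ℂ`
with `Q_h(φ^*x, y) = Q_h(x, J'y)` (e.g. `J' = (φ†)^*`); suppose moreover that EVERY EIGENSPACE OF `φ^*` IS
`Q_h`-ISOTROPIC (no symplectic block: `ν̄ ≠ ν` for every eigenvalue, all blocks are `GL(V_ν)` on
`V_ν ⊕ V_ν̄`, "the standard representation and its contragredient" — Milne §2, type IV with `d = 1`) and that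
the eigenspaces have a common dimension `n`. Then for every `N`, every class of `H^{2p}(A^{N+1}(ℂ); ℂ)`
fixed by `⋀^{2p}u` for all `u ∈ S(A^{N+1})(ℂ) = unitaryCentralizerGroup (A.powSucc N) (Σᵢ prᵢ^* h)` lies in
`Dᵖ(A^{N+1}) ⊗ ℂ` ("each of the `k`-algebras `(⋀^* rH_σ)^{S_σ}` is generated by tensors of degree 2",
`r = N + 1`, `S_σ = GL`). Proof in the module docstring: the `GL`-with-multiplicity criterion
`mem_divisorClassesSpan_of_forall_exteriorPullback_eq_of_glColouring` on the letters `prⱼ^* e^k_i`,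
`prⱼ^* f^k_i`, the diagonal images of the block automorphisms `glBlockEquiv`, and
`θ_k = Σᵢ e^k_i ⌣ f^k_i ∈ B¹(A) ⊗ ℂ` by Prop. 3.3 with its crossed pull-backs by §2.
[cite: Milne1999LefschetzClasses, §1 p. 643, §2 pp. 650–651, Props. 3.3–3.4, 3.6 (c), p. 656, Cor. 4.5 (p. 659)]
[cite: GoodmanWallachGTM255, Thm. 5.3.1] -/
theorem mem_divisorClassesSpan_powSucc_of_forall_exteriorPullback_eq_of_isotropic (φ : A ⟶ A)
    (hC : centralizerAlgebra A = Subalgebra.centralizer ℂ {pullbackOne A φ})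
    (hdiag : ⨆ μ : ℂ, Module.End.eigenspace (pullbackOne A φ) μ = ⊤)
    {h : complexBetti A.X 2} (hQ : IsRationalClass h)
    (hK : ∃ s : ℝ, 0 < s ∧ IsKaehlerClass A.dim A.X ((s : ℂ) • h))
    (J' : Module.End ℂ (complexBetti A.X 1))
    (hJ' : J' ∈ Subalgebra.centralizer ℂ (centralizerAlgebra A : Set (Module.End ℂ (complexBetti A.X 1))))
    (hJQ : ∀ x y : complexBetti A.X 1,
      polarizationPairingOne A.X h (A.dim - 1) (pullbackOne A φ x) y =
        polarizationPairingOne A.X h (A.dim - 1) x (J' y))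
    (hiso : ∀ (μ : ℂ) (x y : complexBetti A.X 1), x ∈ Module.End.eigenspace (pullbackOne A φ) μ →
      y ∈ Module.End.eigenspace (pullbackOne A φ) μ → polarizationPairingOne A.X h (A.dim - 1) x y = 0)
    {n : ℕ} (hn : ∀ μ : ℂ, Module.End.eigenspace (pullbackOne A φ) μ ≠ ⊥ →
      Module.finrank ℂ (Module.End.eigenspace (pullbackOne A φ) μ) = n)
    (N p : ℕ) (x : complexBetti (A.powSucc N).X (2 * p))
    (hx : ∀ u ∈ unitaryCentralizerGroup (A.powSucc N) (powPolarizationClass A h N),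
      exteriorPullback (AbelianVariety.hasExteriorCohomologyH1_complexPoints (A.powSucc N))
        (u : complexBetti (A.powSucc N).X 1 →ₗ[ℂ] complexBetti (A.powSucc N).X 1) (2 * p) x = x) :
    x ∈ divisorClassesSpan (A.powSucc N).X (A.powSucc N).dim p := by
  classical
  haveI : Module.Finite ℂ (complexBetti A.X 1) := abelianVarietyCohomologyExteriorH1_holds.finite_one A
  haveI : Module.Finite ℂ (complexBetti (A.powSucc N).X 1) :=
    abelianVarietyCohomologyExteriorH1_holds.finite_one (A.powSucc N)
  have hX := AbelianVariety.hasExteriorCohomologyH1_complexPoints (A.powSucc N)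
  have hXA := AbelianVariety.hasExteriorCohomologyH1_complexPoints A
  -- degree `0`: everything is a multiple of the unit class
  rcases Nat.eq_zero_or_pos p with rfl | hp1
  · have htop : Submodule.span ℂ (Set.range (cupPowOne ℂ (ComplexPoints (A.powSucc N).X) 0)) = ⊤ :=
      hX.span_range_cupPowOne 0
    have hrange : Set.range (cupPowOne ℂ (ComplexPoints (A.powSucc N).X) 0) =
        {singularCohomology.one ℂ (ComplexPoints (A.powSucc N).X)} := by
      ext c
      simp only [Set.mem_range, cupPowOne_zero, Set.mem_singleton_iff]
      exact ⟨fun ⟨_, e⟩ => e.symm, fun e => ⟨fun i => Fin.elim0 i, e.symm⟩⟩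
    have hx' : x ∈ Submodule.span ℂ (Set.range (cupPowOne ℂ (ComplexPoints (A.powSucc N).X) 0)) := by
      rw [htop]; exact Submodule.mem_top
    rw [hrange] at hx'
    refine Submodule.span_mono (fun c hc => ?_) hx'
    rw [Set.mem_singleton_iff] at hc
    exact mem_divisorMonomials_zero.2 hc
  -- dimension `0`: no classes in positive degree
  rcases Nat.eq_zero_or_pos A.dim with hA | hA0
  · haveI : Subsingleton (complexBetti (A.powSucc N).X (2 * p)) :=
      hX.subsingleton_of_lt (by rw [AbelianVariety.finrank_complexBetti_one, dim_powSucc_eq_succ_mul, hA]; omega)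
    rw [Subsingleton.elim x 0]
    exact Submodule.zero_mem _
  -- the polarization data of `A`
  obtain ⟨s, hs, hKs⟩ := hK
  have hnd := eq_zero_of_forall_polarizationPairingOne_eq_zero_of_isKaehlerClass_smul' hs.ne' hKs
  have hh : h ∈ hodgeClassSpan A.dim A.X 1 := mem_hodgeClassSpan_one_of_isKaehlerClass_smul hQ hs.ne' hKs
  obtain ⟨B, hBalt, hBnd, lam, hlam, hBapp⟩ := exists_bilinForm_isAlt_nondegenerate (A := A) hnd
  set J : Module.End ℂ (complexBetti A.X 1) := pullbackOne A φ with hJ_def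
  have hJB : ∀ x y, B (J x) y = B x (J' y) := fun x y => by rw [hBapp, hBapp, hJ_def, hJQ]
  -- `J'` lies in the double commutant of `J`, hence is a scalar `c ν` on each eigenspace `V_ν(J)`
  have hJ'' : ∀ S : Module.End ℂ (complexBetti A.X 1), S * J = J * S → S * J' = J' * S := by
    intro S hS
    have hSC : S ∈ centralizerAlgebra A := by
      rw [hC, Subalgebra.mem_centralizer_iff]
      intro g hg
      rw [Set.mem_singleton_iff] at hg
      rw [hg, hJ_def]
      exact hS.symm
    exact (Subalgebra.mem_centralizer_iff ℂ |>.1 hJ') S hSC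
  have hsc := fun μ => exists_forall_mem_eigenspace_apply_eq_smul J J' hdiag hJ'' μ
  choose c hc using hsc
  have horth : ∀ (μ ν : ℂ) (x y : complexBetti A.X 1), x ∈ J.eigenspace μ → y ∈ J.eigenspace ν →
      μ ≠ c ν → B x y = 0 := fun μ ν x y hx hy hμν =>
    apply_eq_zero_of_mem_eigenspace_of_apply_eq_smul B J J' hJB hμν hx (hc ν y hy)
  -- the block basis adapted to the adjoint pair
  obtain ⟨m, nk, ν, b₁, hsep, hcν, hJ1, hJ2, hcross, h11, h22, h12⟩ :=
    exists_blockBasis_of_orthogonality B hBalt hBnd J hdiag c horth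
  -- no block is symplectic: `c (ν k) ≠ ν k` for every non-empty block
  have hne : ∀ k : Fin m, 0 < nk k → c (ν k) ≠ ν k := by
    intro k hk heq
    have he : b₁ ⟨k, Sum.inl ⟨0, hk⟩⟩ ∈ J.eigenspace (ν k) := Module.End.mem_eigenspace_iff.2 (hJ1 k _)
    have hf : b₁ ⟨k, Sum.inr ⟨0, hk⟩⟩ ∈ J.eigenspace (ν k) := by
      rw [Module.End.mem_eigenspace_iff, hJ2, heq]
    have h0 := hiso (ν k) _ _ he hf
    have h1 := h12 k ⟨0, hk⟩ ⟨0, hk⟩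
    rw [if_pos rfl, hBapp, h0, map_zero] at h1
    exact zero_ne_one h1
  -- the eigenvalue of each basis vector; eigenspaces are spanned blockwise
  let ev₁ : (Σ k : Fin m, Fin (nk k) ⊕ Fin (nk k)) → ℂ := fun a => Sum.elim (fun _ => ν a.1) (fun _ => c (ν a.1)) a.2
  have hJb₁ : ∀ a, J (b₁ a) = ev₁ a • b₁ a := by
    rintro ⟨k, i | i⟩
    exacts [hJ1 k i, hJ2 k i]
  have hVk : ∀ k : Fin m, 0 < nk k →
      J.eigenspace (ν k) = Submodule.span ℂ (Set.range fun i : Fin (nk k) => b₁ ⟨k, Sum.inl i⟩) := by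
    intro k hk
    rw [eigenspace_eq_span_image_of_eigenbasis b₁ J ev₁ hJb₁]
    congr 1
    ext v
    constructor
    · rintro ⟨⟨k', i | i⟩, ha, rfl⟩
      · change ν k' = ν k at ha
        obtain rfl := hsep k k' (Or.inl ha)
        exact ⟨i, rfl⟩
      · change c (ν k') = ν k at ha
        have hk' : ν k' = c (ν k) := by rw [← ha, hcν]
        obtain rfl := hsep k k' (Or.inr hk')
        exact absurd ha (hne k' hk)
    · rintro ⟨i, rfl⟩
      exact ⟨⟨k, Sum.inl i⟩, rfl, rfl⟩
  -- every non-empty block has `n` letters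
  have hnk : ∀ k : Fin m, 0 < nk k → nk k = n := by
    intro k hk
    have hli : LinearIndependent ℂ (fun i : Fin (nk k) => b₁ ⟨k, Sum.inl i⟩) :=
      b₁.linearIndependent.comp (fun i : Fin (nk k) => (⟨k, Sum.inl i⟩ : Σ k : Fin m, Fin (nk k) ⊕ Fin (nk k)))
        fun i j hij => by simpa using hij
    have hbot : J.eigenspace (ν k) ≠ ⊥ := by
      intro hbot
      have hmem : b₁ ⟨k, Sum.inl ⟨0, hk⟩⟩ ∈ J.eigenspace (ν k) := Module.End.mem_eigenspace_iff.2 (hJ1 k _)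
      rw [hbot, Submodule.mem_bot] at hmem
      exact b₁.ne_zero _ hmem
    have e := hn (ν k) hbot
    rw [hVk k hk, finrank_span_eq_card hli, Fintype.card_fin] at e
    exact e
  -- reindex the non-empty blocks uniformly: slots `(k, β)`, letters `Fin n`
  let K := {k : Fin m // 0 < nk k}
  let E : (Σ k : Fin m, Fin (nk k) ⊕ Fin (nk k)) ≃ (K × Bool) × Fin n :=
    { toFun := fun a => match a with
        | ⟨k, Sum.inl i⟩ => ((⟨k, i.pos⟩, true), Fin.cast (hnk k i.pos) i)
        | ⟨k, Sum.inr i⟩ => ((⟨k, i.pos⟩, false), Fin.cast (hnk k i.pos) i)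
      invFun := fun a => match a with
        | ((k, true), i) => ⟨k.1, Sum.inl (Fin.cast (hnk k.1 k.2).symm i)⟩
        | ((k, false), i) => ⟨k.1, Sum.inr (Fin.cast (hnk k.1 k.2).symm i)⟩
      left_inv := by rintro ⟨k, i | i⟩ <;> rfl
      right_inv := by rintro ⟨⟨k, _ | _⟩, i⟩ <;> rfl }
  let b : Module.Basis ((K × Bool) × Fin n) ℂ (complexBetti A.X 1) := b₁.reindex E
  have hbt : ∀ (k : K) (i : Fin n), b ((k, true), i) = b₁ ⟨k.1, Sum.inl (Fin.cast (hnk k.1 k.2).symm i)⟩ :=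
    fun k i => Module.Basis.reindex_apply _ _ _
  have hbf : ∀ (k : K) (i : Fin n), b ((k, false), i) = b₁ ⟨k.1, Sum.inr (Fin.cast (hnk k.1 k.2).symm i)⟩ :=
    fun k i => Module.Basis.reindex_apply _ _ _
  -- the slot eigenvalues, injective on slots
  let ev : K × Bool → ℂ := fun s => if s.2 then ν s.1.1 else c (ν s.1.1)
  have hJb : ∀ a, J (b a) = ev a.1 • b a := by
    rintro ⟨⟨k, _ | _⟩, i⟩
    · rw [hbf, hJ2]; rfl
    · rw [hbt, hJ1]; rfl
  have hev : ∀ s s' : K × Bool, ev s = ev s' → s = s' := by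
    rintro ⟨k, β⟩ ⟨k', β'⟩ hss
    cases β <;> cases β'
    · change c (ν k.1) = c (ν k'.1) at hss
      have e : ν k.1 = ν k'.1 := by rw [← hcν k.1, hss, hcν]
      have hk : k'.1 = k.1 := hsep k.1 k'.1 (Or.inl e.symm)
      rw [Prod.mk.injEq]
      exact ⟨Subtype.ext hk.symm, rfl⟩
    · change c (ν k.1) = ν k'.1 at hss
      have hk : k'.1 = k.1 := hsep k.1 k'.1 (Or.inr hss.symm)
      rw [hk] at hss
      exact absurd hss (hne k.1 k.2)
    · change ν k.1 = c (ν k'.1) at hss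
      have hk : k.1 = k'.1 := hsep k'.1 k.1 (Or.inr hss)
      rw [hk] at hss
      exact absurd hss.symm (hne k'.1 k'.2)
    · change ν k.1 = ν k'.1 at hss
      have hk : k'.1 = k.1 := hsep k.1 k'.1 (Or.inl hss.symm)
      rw [Prod.mk.injEq]
      exact ⟨Subtype.ext hk.symm, rfl⟩
  -- the `B`-relations on the reindexed basis
  have hcrossB : ∀ a a' : (K × Bool) × Fin n, a.1.1 ≠ a'.1.1 → B (b a) (b a') = 0 := by
    rintro ⟨⟨k, β⟩, i⟩ ⟨⟨k', β'⟩, i'⟩ hkk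
    have hkk' : k.1 ≠ k'.1 := fun e => hkk (Subtype.ext e)
    cases β <;> cases β' <;> simp only [hbt, hbf] <;> exact hcross _ _ hkk'
  have htt : ∀ (k : K) (i j : Fin n), B (b ((k, true), i)) (b ((k, true), j)) = 0 := fun k i j => by
    rw [hbt, hbt, h11]
  have hff : ∀ (k : K) (i j : Fin n), B (b ((k, false), i)) (b ((k, false), j)) = 0 := fun k i j => by
    rw [hbf, hbf, h22]
  have htf : ∀ (k : K) (i j : Fin n), B (b ((k, true), i)) (b ((k, false), j)) = if i = j then 1 else 0 := by
    intro k i j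
    rw [hbt, hbf, h12]
    by_cases hij : i = j
    · subst hij; rw [if_pos rfl, if_pos rfl]
    · rw [if_neg hij, if_neg]
      exact fun e => hij (Fin.cast_injective _ e)
  have hft : ∀ (k : K) (i j : Fin n), B (b ((k, false), i)) (b ((k, true), j)) = if i = j then -1 else 0 := by
    intro k i j
    rw [← hBalt.neg_eq, htf]
    by_cases hij : i = j
    · subst hij; simp
    · rw [if_neg (Ne.symm hij), if_neg hij, neg_zero]
  -- membership in `S(A)(ℂ)`: commute with `J` (hence with `End(A)`, by `hC`) and preserve `B`
  have hmem : ∀ u : complexBetti A.X 1 ≃ₗ[ℂ] complexBetti A.X 1,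
      J * (u : Module.End ℂ (complexBetti A.X 1)) = (u : Module.End ℂ (complexBetti A.X 1)) * J →
      (∀ a c, B (u a) (u c) = B a c) → u ∈ unitaryCentralizerGroup A h := by
    intro u hcomm hu
    refine ⟨mem_centralizerGroup_iff_coe_mem.2 ?_, fun a c => hlam (by rw [← hBapp, ← hBapp, hu a c])⟩
    rw [hC, Subalgebra.mem_centralizer_iff]
    intro g hg
    rw [Set.mem_singleton_iff] at hg
    rw [hg]
    exact hcomm
  have hofmem : ∀ u ∈ unitaryCentralizerGroup A h,
      (∀ v, J (u v) = u (J v)) ∧ ∀ a c, B (u a) (u c) = B a c := by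
    intro u hu
    refine ⟨fun v => ?_, fun a c => by rw [hBapp, hBapp, hu.2]⟩
    have hc := mem_centralizerGroup_iff_coe_mem.1 hu.1
    rw [hC, Subalgebra.mem_centralizer_iff] at hc
    have e := hc J (Set.mem_singleton J)
    exact LinearMap.congr_fun e v
  -- the pairing classes `θ_k = Σᵢ e^k_i ⌣ f^k_i` are divisor classes (Prop. 3.3, `S(ℂ)`-form)
  have hθ : ∀ k : K, (∑ i, cupProduct (rfl : 1 + 1 = 2) (b ((k, true), i)) (b ((k, false), i))) ∈
      Submodule.span ℂ {c : complexBetti A.X 2 | IsRationalClass c ∧ IsOfHodgeType A.dim A.X 2 1 1 c} := fun k =>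
    mem_hodgeClassSpan_of_forall_exteriorPullback_eq hh (p := 1) fun u hu =>
      exteriorPullback_sum_cupProduct_eq_self_of_blocks b B htf J ev hJb hev k u (hofmem u hu).1 (hofmem u hu).2
  -- the letters of `H¹(A^{N+1})`: `prⱼ^* b(s, i)`
  let y : (Fin (N + 1) × (K × Bool)) × Fin n → complexBetti (A.powSucc N).X 1 := fun sl =>
    complexBetti.map (powSlots A N sl.1.1).hom.hom.hom 1 (b (sl.1.2, sl.2))
  have hy : ∀ j sg i, y ((j, sg), i) = complexBetti.map (powSlots A N j).hom.hom.hom 1 (b (sg, i)) := fun _ _ _ => rfl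
  have hyspan : ⊤ ≤ Submodule.span ℂ (Set.range y) := by
    intro z _
    have hz := mem_span_map_powSlots A N z
    refine (Submodule.span_le.2 ?_) hz
    rintro _ ⟨⟨j, v⟩, rfl⟩
    change complexBetti.map (powSlots A N j).hom.hom.hom 1 v ∈ Submodule.span ℂ (Set.range y)
    rw [← b.sum_repr v, map_sum]
    refine Submodule.sum_mem _ fun a _ => ?_
    rw [map_smul]
    exact Submodule.smul_mem _ _ (Submodule.subset_span ⟨((j, a.1), a.2), rfl⟩)
  have hcard : Fintype.card ((Fin (N + 1) × (K × Bool)) × Fin n) =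
      Module.finrank ℂ (complexBetti (A.powSucc N).X 1) := by
    rw [AbelianVariety.finrank_complexBetti_one, dim_powSucc_eq_succ_mul]
    have hA2 : 2 * A.dim = Fintype.card ((K × Bool) × Fin n) := by
      rw [← AbelianVariety.finrank_complexBetti_one, Module.finrank_eq_card_basis b]
    simp only [Fintype.card_prod, Fintype.card_fin, Fintype.card_bool] at hA2 ⊢
    calc (N + 1) * (Fintype.card K * 2) * n = (N + 1) * (Fintype.card K * 2 * n) := by ring
      _ = (N + 1) * (2 * A.dim) := by rw [hA2]
      _ = 2 * ((N + 1) * A.dim) := by ring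
  obtain ⟨bB, hbB⟩ : ∃ bB : Module.Basis ((Fin (N + 1) × (K × Bool)) × Fin n) ℂ
      (complexBetti (A.powSucc N).X 1), ∀ sl, bB sl = y sl :=
    ⟨basisOfTopLeSpanOfCardEqFinrank y hyspan hcard, fun sl => by rw [coe_basisOfTopLeSpanOfCardEqFinrank]⟩
  -- THE CRITERION (Prop. 3.6 (c) with multiplicity)
  refine mem_divisorClassesSpan_of_forall_exteriorPullback_eq_of_glColouring bB (fun sg => sg.2.1) (fun sg => sg.2.2)
    (unitaryCentralizerGroup (A.powSucc N) (powPolarizationClass A h N)) (fun g => ?_) ?_ p x hx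
  · -- the diagonal image of the block automorphism `g`
    have hu₀ : glBlockEquiv b g ∈ unitaryCentralizerGroup A h :=
      hmem _ (glBlockEquiv_comm b g J ev hJb) (glBlockEquiv_preserves b g B hcrossB htt hff htf hft)
    refine ⟨diagPow A (glBlockEquiv b g) N, diagPow_mem_unitaryCentralizerGroup hA0 hu₀ N, fun sg ℓ => ?_⟩
    obtain ⟨j, sg⟩ := sg
    rw [hbB, hy, diagPow_intertwine_right hu₀.1, glBlockEquiv_basis, map_sum]
    refine Finset.sum_congr rfl fun ℓ' _ => ?_
    rw [map_smul, hbB, hy]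
    rfl
  · -- crossed classes of a vector and a covector slot of the same block are divisor classes
    rintro ⟨j, ⟨k, β⟩⟩ ⟨j', ⟨k', β'⟩⟩ hβ hβ' hkk
    change β = true at hβ
    change β' = false at hβ'
    change k = k' at hkk
    subst hβ hβ' hkk
    simp only [hbB, hy]
    exact sum_cross_mem_span_rational_oneOne_of_eigen φ (powSlots A N j) (powSlots A N j')
      (fun ℓ => b ((k, true), ℓ)) (fun ℓ => b ((k, false), ℓ)) (Ne.symm (hne k.1 k.2))
      (fun ℓ => hJb ((k, true), ℓ)) (fun ℓ => hJb ((k, false), ℓ)) (hθ k)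

/-- **The polarization package of every power `A^{N+1}` of an abelian variety with general linear blocks only**
(`0 < dim A`): Milne's class `Σᵢ prᵢ^* h ∈ B¹(A^{N+1}) ⊗ ℂ` with `(Σᵢ prᵢ^* h)^{dim} ≠ 0`, `Q` non-degenerate
(`SpecialLefschetzGroupOneEqUnitaryCentralizer` §Powers) and the `S(ℂ)`-form above — the datum consumed by
`SpecialLefschetzGroupInvariantsFiniteProducts` (packages of factors ⇒ packages of finite `Hom`-orthogonal
products). [cite: Milne1999LefschetzClasses, §1 p. 643, Prop. 3.4, Cor. 4.5 (p. 659)] -/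
theorem exists_polarization_invariants_le_powSucc_of_isotropic (φ : A ⟶ A)
    (hC : centralizerAlgebra A = Subalgebra.centralizer ℂ {pullbackOne A φ})
    (hdiag : ⨆ μ : ℂ, Module.End.eigenspace (pullbackOne A φ) μ = ⊤)
    {h : complexBetti A.X 2} (hQ : IsRationalClass h)
    (hK : ∃ s : ℝ, 0 < s ∧ IsKaehlerClass A.dim A.X ((s : ℂ) • h))
    (J' : Module.End ℂ (complexBetti A.X 1))
    (hJ' : J' ∈ Subalgebra.centralizer ℂ (centralizerAlgebra A : Set (Module.End ℂ (complexBetti A.X 1))))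
    (hJQ : ∀ x y : complexBetti A.X 1,
      polarizationPairingOne A.X h (A.dim - 1) (pullbackOne A φ x) y =
        polarizationPairingOne A.X h (A.dim - 1) x (J' y))
    (hiso : ∀ (μ : ℂ) (x y : complexBetti A.X 1), x ∈ Module.End.eigenspace (pullbackOne A φ) μ →
      y ∈ Module.End.eigenspace (pullbackOne A φ) μ → polarizationPairingOne A.X h (A.dim - 1) x y = 0)
    {n : ℕ} (hn : ∀ μ : ℂ, Module.End.eigenspace (pullbackOne A φ) μ ≠ ⊥ →
      Module.finrank ℂ (Module.End.eigenspace (pullbackOne A φ) μ) = n)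
    (hA0 : 0 < A.dim) (N : ℕ) :
    ∃ D : complexBetti (A.powSucc N).X 2, D ∈ hodgeClassSpan (A.powSucc N).dim (A.powSucc N).X 1 ∧
      lefschetzPow D ((A.powSucc N).dim - 1) 2 D ≠ 0 ∧
      (∀ z : complexBetti (A.powSucc N).X 1,
        (∀ y, polarizationPairingOne (A.powSucc N).X D ((A.powSucc N).dim - 1) z y = 0) → z = 0) ∧
      ∀ (a : ℕ) (y : complexBetti (A.powSucc N).X (2 * a)), (∀ u ∈ unitaryCentralizerGroup (A.powSucc N) D,
        exteriorPullback (AbelianVariety.hasExteriorCohomologyH1_complexPoints (A.powSucc N))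
          (u : complexBetti (A.powSucc N).X 1 →ₗ[ℂ] complexBetti (A.powSucc N).X 1) (2 * a) y = y) →
        y ∈ divisorClassesSpan (A.powSucc N).X (A.powSucc N).dim a := by
  obtain ⟨s, hs, hKs⟩ := hK
  have hnd := eq_zero_of_forall_polarizationPairingOne_eq_zero_of_isKaehlerClass_smul' hs.ne' hKs
  have hh : h ∈ hodgeClassSpan A.dim A.X 1 := mem_hodgeClassSpan_one_of_isKaehlerClass_smul hQ hs.ne' hKs
  have htop : lefschetzPow h (A.dim - 1) 2 h ≠ 0 := lefschetzPow_self_ne_zero_of_isKaehlerClass_smul hA0 hKs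
  exact ⟨powPolarizationClass A h N, powPolarizationClass_mem_hodgeClassSpan hh N,
    lefschetzPow_powPolarizationClass_self_ne_zero hA0 htop N,
    eq_zero_of_forall_polarizationPairingOne_powPolarizationClass_eq_zero hA0 htop hnd N,
    fun a y hy => mem_divisorClassesSpan_powSucc_of_forall_exteriorPullback_eq_of_isotropic φ hC hdiag hQ
      ⟨s, hs, hKs⟩ J' hJ' hJQ hiso hn N a y hy⟩

/-- **The conclusion of the record `Milne1999_specialLefschetzGroup_invariants_le` (Milne 1999, Cor. 4.5 with
Thm. 4.4, Thm. 3.2 and Prop. 3.6 (c) WITH MULTIPLICITY) PROVED for every power of an abelian variety with general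
linear blocks only**: for `A` as in `mem_divisorClassesSpan_powSucc_of_forall_exteriorPullback_eq_of_isotropic`
and every `N`, every class `x ∈ H^{2p}(A^{N+1}(ℂ); ℂ)` fixed by every element of
`specialLefschetzGroup (dim A^{N+1}) (A^{N+1}).X` lies in `Dᵖ_hom(A^{N+1})_ℂ` (`A^{N+1} = A.powSucc N`; in
dimension `0` there is nothing to prove). [cite: Milne1999LefschetzClasses, Cor. 4.5 and Cor. 4.7 (p. 659), Thm. 3.2, Prop. 3.6 (c), p. 656]
[cite: GoodmanWallachGTM255, Thm. 5.3.1] -/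
theorem specialLefschetzGroup_invariants_le_powSucc_of_isotropic (φ : A ⟶ A)
    (hC : centralizerAlgebra A = Subalgebra.centralizer ℂ {pullbackOne A φ})
    (hdiag : ⨆ μ : ℂ, Module.End.eigenspace (pullbackOne A φ) μ = ⊤)
    {h : complexBetti A.X 2} (hQ : IsRationalClass h)
    (hK : ∃ s : ℝ, 0 < s ∧ IsKaehlerClass A.dim A.X ((s : ℂ) • h))
    (J' : Module.End ℂ (complexBetti A.X 1))
    (hJ' : J' ∈ Subalgebra.centralizer ℂ (centralizerAlgebra A : Set (Module.End ℂ (complexBetti A.X 1))))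
    (hJQ : ∀ x y : complexBetti A.X 1,
      polarizationPairingOne A.X h (A.dim - 1) (pullbackOne A φ x) y =
        polarizationPairingOne A.X h (A.dim - 1) x (J' y))
    (hiso : ∀ (μ : ℂ) (x y : complexBetti A.X 1), x ∈ Module.End.eigenspace (pullbackOne A φ) μ →
      y ∈ Module.End.eigenspace (pullbackOne A φ) μ → polarizationPairingOne A.X h (A.dim - 1) x y = 0)
    {n : ℕ} (hn : ∀ μ : ℂ, Module.End.eigenspace (pullbackOne A φ) μ ≠ ⊥ →
      Module.finrank ℂ (Module.End.eigenspace (pullbackOne A φ) μ) = n)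
    (N p : ℕ) (x : complexBetti (A.powSucc N).X (2 * p))
    (hx : ∀ g ∈ specialLefschetzGroup (A.powSucc N).dim (A.powSucc N).X, g (2 * p) x = x) :
    x ∈ divisorClassesSpan (A.powSucc N).X (A.powSucc N).dim p := by
  classical
  have hX := AbelianVariety.hasExteriorCohomologyH1_complexPoints (A.powSucc N)
  rcases Nat.eq_zero_or_pos A.dim with hA | hA0
  · -- dimension `0`: `H^{2p}(A^{N+1}) = 0` for `p ≥ 1`, `H⁰ = ℂ · 1`
    rcases Nat.eq_zero_or_pos p with rfl | hp1
    · have htop : Submodule.span ℂ (Set.range (cupPowOne ℂ (ComplexPoints (A.powSucc N).X) 0)) = ⊤ :=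
        hX.span_range_cupPowOne 0
      have hrange : Set.range (cupPowOne ℂ (ComplexPoints (A.powSucc N).X) 0) =
          {singularCohomology.one ℂ (ComplexPoints (A.powSucc N).X)} := by
        ext c
        simp only [Set.mem_range, cupPowOne_zero, Set.mem_singleton_iff]
        exact ⟨fun ⟨_, e⟩ => e.symm, fun e => ⟨fun i => Fin.elim0 i, e.symm⟩⟩
      have hx' : x ∈ Submodule.span ℂ (Set.range (cupPowOne ℂ (ComplexPoints (A.powSucc N).X) 0)) := by
        rw [htop]; exact Submodule.mem_top
      rw [hrange] at hx'
      refine Submodule.span_mono (fun c hc => ?_) hx'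
      rw [Set.mem_singleton_iff] at hc
      exact mem_divisorMonomials_zero.2 hc
    · haveI : Module.Finite ℂ (complexBetti (A.powSucc N).X 1) :=
        abelianVarietyCohomologyExteriorH1_holds.finite_one (A.powSucc N)
      haveI : Subsingleton (complexBetti (A.powSucc N).X (2 * p)) :=
        hX.subsingleton_of_lt (by rw [AbelianVariety.finrank_complexBetti_one, dim_powSucc_eq_succ_mul, hA]; omega)
      rw [Subsingleton.elim x 0]
      exact Submodule.zero_mem _
  · exact specialLefschetzGroup_invariants_le_of_exists_polarization_invariants_le (dim_powSucc_pos hA0 N)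
      (exists_polarization_invariants_le_powSucc_of_isotropic φ hC hdiag hQ hK J' hJ' hJQ hiso hn hA0 N) p x hx

/-- **The record for every complex abelian variety ISOGENOUS to a power of an abelian variety with general linear
blocks only** ("`S(A)` depends only on the isogeny class of `A`", §1 p. 644; Cor. 4.7).
[cite: Milne1999LefschetzClasses, §1 p. 644, Prop. 1.5, Cor. 4.5 and Cor. 4.7 (p. 659)] -/
theorem specialLefschetzGroup_invariants_le_of_isIsogenous_powSucc_of_isotropic {X : AbelianVariety ℂ}
    (φ : A ⟶ A) (hC : centralizerAlgebra A = Subalgebra.centralizer ℂ {pullbackOne A φ})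
    (hdiag : ⨆ μ : ℂ, Module.End.eigenspace (pullbackOne A φ) μ = ⊤)
    {h : complexBetti A.X 2} (hQ : IsRationalClass h)
    (hK : ∃ s : ℝ, 0 < s ∧ IsKaehlerClass A.dim A.X ((s : ℂ) • h))
    (J' : Module.End ℂ (complexBetti A.X 1))
    (hJ' : J' ∈ Subalgebra.centralizer ℂ (centralizerAlgebra A : Set (Module.End ℂ (complexBetti A.X 1))))
    (hJQ : ∀ x y : complexBetti A.X 1,
      polarizationPairingOne A.X h (A.dim - 1) (pullbackOne A φ x) y =
        polarizationPairingOne A.X h (A.dim - 1) x (J' y))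
    (hiso : ∀ (μ : ℂ) (x y : complexBetti A.X 1), x ∈ Module.End.eigenspace (pullbackOne A φ) μ →
      y ∈ Module.End.eigenspace (pullbackOne A φ) μ → polarizationPairingOne A.X h (A.dim - 1) x y = 0)
    {n : ℕ} (hn : ∀ μ : ℂ, Module.End.eigenspace (pullbackOne A φ) μ ≠ ⊥ →
      Module.finrank ℂ (Module.End.eigenspace (pullbackOne A φ) μ) = n)
    (hA0 : 0 < A.dim) {N : ℕ} (hXA : AbelianVariety.IsIsogenous X (A.powSucc N)) (p : ℕ)
    (x : complexBetti X.X (2 * p)) (hx : ∀ g ∈ specialLefschetzGroup X.dim X.X, g (2 * p) x = x) :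
    x ∈ divisorClassesSpan X.X X.dim p :=
  specialLefschetzGroup_invariants_le_of_isIsogenous_of_exists hXA (dim_powSucc_pos hA0 N)
    (exists_polarization_invariants_le_powSucc_of_isotropic φ hC hdiag hQ hK J' hJ' hJQ hiso hn hA0 N) p x hx

/-- **Cor. 4.5 as an equality of sets on the powers of an abelian variety with general linear blocks only**:
the `S(A^{N+1})`-invariants of `H^{2p}(A^{N+1}(ℂ); ℂ)` are EXACTLY `Dᵖ_hom(A^{N+1})_ℂ` (the converse inclusion is
definitional, `apply_eq_self_of_mem_specialLefschetzGroup`). [cite: Milne1999LefschetzClasses, Cor. 4.5 (p. 659)] -/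
theorem setOf_forall_apply_eq_self_eq_divisorClassesSpan_powSucc_of_isotropic (φ : A ⟶ A)
    (hC : centralizerAlgebra A = Subalgebra.centralizer ℂ {pullbackOne A φ})
    (hdiag : ⨆ μ : ℂ, Module.End.eigenspace (pullbackOne A φ) μ = ⊤)
    {h : complexBetti A.X 2} (hQ : IsRationalClass h)
    (hK : ∃ s : ℝ, 0 < s ∧ IsKaehlerClass A.dim A.X ((s : ℂ) • h))
    (J' : Module.End ℂ (complexBetti A.X 1))
    (hJ' : J' ∈ Subalgebra.centralizer ℂ (centralizerAlgebra A : Set (Module.End ℂ (complexBetti A.X 1))))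
    (hJQ : ∀ x y : complexBetti A.X 1,
      polarizationPairingOne A.X h (A.dim - 1) (pullbackOne A φ x) y =
        polarizationPairingOne A.X h (A.dim - 1) x (J' y))
    (hiso : ∀ (μ : ℂ) (x y : complexBetti A.X 1), x ∈ Module.End.eigenspace (pullbackOne A φ) μ →
      y ∈ Module.End.eigenspace (pullbackOne A φ) μ → polarizationPairingOne A.X h (A.dim - 1) x y = 0)
    {n : ℕ} (hn : ∀ μ : ℂ, Module.End.eigenspace (pullbackOne A φ) μ ≠ ⊥ →
      Module.finrank ℂ (Module.End.eigenspace (pullbackOne A φ) μ) = n)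
    (N p : ℕ) :
    {x : complexBetti (A.powSucc N).X (2 * p) |
        ∀ g ∈ specialLefschetzGroup (A.powSucc N).dim (A.powSucc N).X, g (2 * p) x = x} =
      (divisorClassesSpan (A.powSucc N).X (A.powSucc N).dim p : Set _) :=
  Set.Subset.antisymm
    (fun x hx => specialLefschetzGroup_invariants_le_powSucc_of_isotropic φ hC hdiag hQ hK J' hJ' hJQ hiso hn N p x hx)
    fun _ hx _ hg => apply_eq_self_of_mem_specialLefschetzGroup hg hx

/-- **Milne Prop. 4.8, (c) ⇒ (a) on every power of an abelian variety with general linear blocks only,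
record-free**: if `Hg′(A^{N+1}) = S(A^{N+1})` then `A^{N+1}` supports no exotic Hodge class (van Geemen's
`B(A^{N+1}) = D(A^{N+1})`). [cite: Milne1999LefschetzClasses, Prop. 4.8 and Cor. 4.5 (pp. 659–660)] -/
theorem isDivisorGenerated_powSucc_of_hodgeGroup_eq_specialLefschetzGroup_of_isotropic (φ : A ⟶ A)
    (hC : centralizerAlgebra A = Subalgebra.centralizer ℂ {pullbackOne A φ})
    (hdiag : ⨆ μ : ℂ, Module.End.eigenspace (pullbackOne A φ) μ = ⊤)
    {h : complexBetti A.X 2} (hQ : IsRationalClass h)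
    (hK : ∃ s : ℝ, 0 < s ∧ IsKaehlerClass A.dim A.X ((s : ℂ) • h))
    (J' : Module.End ℂ (complexBetti A.X 1))
    (hJ' : J' ∈ Subalgebra.centralizer ℂ (centralizerAlgebra A : Set (Module.End ℂ (complexBetti A.X 1))))
    (hJQ : ∀ x y : complexBetti A.X 1,
      polarizationPairingOne A.X h (A.dim - 1) (pullbackOne A φ x) y =
        polarizationPairingOne A.X h (A.dim - 1) x (J' y))
    (hiso : ∀ (μ : ℂ) (x y : complexBetti A.X 1), x ∈ Module.End.eigenspace (pullbackOne A φ) μ →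
      y ∈ Module.End.eigenspace (pullbackOne A φ) μ → polarizationPairingOne A.X h (A.dim - 1) x y = 0)
    {n : ℕ} (hn : ∀ μ : ℂ, Module.End.eigenspace (pullbackOne A φ) μ ≠ ⊥ →
      Module.finrank ℂ (Module.End.eigenspace (pullbackOne A φ) μ) = n)
    (N : ℕ)
    (hHg : hodgeGroup (A.powSucc N).dim (A.powSucc N).X =
      specialLefschetzGroup (A.powSucc N).dim (A.powSucc N).X) :
    IsDivisorGenerated (A.powSucc N) :=
  fun p c hc hpp => specialLefschetzGroup_invariants_le_powSucc_of_isotropic φ hC hdiag hQ hK J' hJ' hJQ hiso hn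
    N p c fun _ hg => apply_eq_self_of_mem_hodgeGroup (hHg ▸ hg) hc hpp

end Main

end Literature.AlgebraicGeometry.Milne1999
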